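import Summits.QuantumFields.YangMills.Theorems.BackwardLiouvilleRigidityFlatRatioTerminationWindowTV
import HarnessLib

/-!
# Crux `FluctuationComparisonRegPrIntL` (stmt-QuantumFields-20520), LINE «run-pair organ» (ym-r3-idea-1 g14) —
registered stub `stub_windowTV` (S4b), BY NAME

The skeleton `Cruxes/FluctuationComparisonRegPrIntL/Lines/runpair_organ.lean` declares S4b `WindowTV` «= `stub_windowTV` of
`Lines/flat_ratio_termination.lean`, BY STATEMENT»: the single-height total-variation bound (positivity of the two densities on the
window, one-bond chains of length `≤ D` from the inner window, one-bond oscillation `τ` of the log-ratio with `τ·D ≤ δ₀`, inner tails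
`≤ δ₀` ⇒ `|μ A − μ' A| ≤ ε`).  That statement is ALREADY A TREE THEOREM for the termination line of route
`BackwardLiouvilleRigidity`: `Summit.QuantumFields.YangMills.Theorems.FlatRatioTermination.stub_windowTV` (p647765).  This file
reproduces the skeleton's Prop `WindowTV` verbatim (definitionally equal to the registered one) and discharges the registered stub by
that theorem — exactly as S4c `stub_integralOfTV` was discharged by p670105.  Cell `ym-idea-1` width seat `ym-line-sfw-p2-w3` g29
(free hands, R3 family).  HONEST FRAMING: registry bookkeeping only; the line's content stubs (S1a/S1b/S2/S3 and the geometric S4a)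
are untouched; no organ, crux, rung or summit is proved; `YM3TorusSU2` and the Yang–Mills mass gap are NOT proved.
-/

set_option autoImplicit false

open MeasureTheory Filter Topology
open Literature.MathematicalPhysics.QuantumFieldTheory.Balaban1983to89 T3ContinuumYM3Torus T3NestedUnitLaws
  T3UnitLawDensityEML T4Continuum BalabanUVClass T3UnitScaleTilt

namespace Summit.QuantumFields.YangMills.Theorems.FluctuationComparisonRegPrIntL.RunPairOrgan

/-- The skeleton's Prop `WindowTV` (S4b, verbatim copy of
`Summit.QuantumFields.YangMills.Cruxes.FluctuationComparisonRegPrIntL.RunPairOrgan.WindowTV`, definitionally equal): the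
single-height total-variation bound from window positivity, inner-window chains, one-bond oscillation and inner tails. -/
def WindowTV : Prop :=
  ∀ ε : ℝ, 0 < ε → ∃ δ₀ : ℝ, 0 < δ₀ ∧ ∀ (F : T3Family) (j D : ℕ) (θin θ τ ηr : ℝ), 0 < θin → 0 ≤ τ → τ * (D : ℝ) ≤ δ₀ → 0 ≤ ηr → ηr ≤ δ₀ → ∀ (μ μ' : MeasureTheory.Measure (GaugeField (F.P j) 0 ↥(Matrix.specialUnitaryGroup (Fin 2) ℂ))) (ρ ρ' : GaugeField (F.P j) 0 ↥(Matrix.specialUnitaryGroup (Fin 2) ℂ) → ℝ), IsProbabilityMeasure μ → IsProbabilityMeasure μ' → (∀ U, PlaqSmall θ U → 0 < ρ U ∧ 0 < ρ' U) → μ = (fieldMeasure _ _ _).withDensity (fun U => ENNReal.ofReal (ρ U)) → μ' = (fieldMeasure _ _ _).withDensity (fun U => ENNReal.ofReal (ρ' U)) → (∀ U : GaugeField (F.P j) 0 ↥(Matrix.specialUnitaryGroup (Fin 2) ℂ), PlaqSmall (θin) U → ∃ (n : ℕ) (W : ℕ → GaugeField (F.P j) 0 ↥(Matrix.specialUnitaryGroup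 (Fin 2) ℂ)), n ≤ D ∧ (∀ e, W 0 e = 1) ∧ W n = U ∧ (∀ i, i ≤ n → PlaqSmall (θ) (W i)) ∧ (∀ i, i < n → ∃ b : PBond (F.P j) 0, ∀ e, e ≠ b → W i e = W (i + 1) e)) → (∀ (b : PBond (F.P j) 0) U V, PlaqSmall θ U → PlaqSmall θ V → (∀ e, e ≠ b → U e = V e) → |(Real.log (ρ U) - Real.log (ρ' U)) - (Real.log (ρ V) - Real.log (ρ' V))| ≤ τ) → μ {U | ¬ PlaqSmall θin U} ≤ ENNReal.ofReal ηr → μ' {U | ¬ PlaqSmall θin U} ≤ ENNReal.ofReal ηr → ∀ A : Set (GaugeField (F.P j) 0 ↥(Matrix.specialUnitaryGroup (Fin 2) ℂ)), MeasurableSet A → |μ.real A - μ'.real A| ≤ ε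

/-- Registered stub `stub_windowTV` of LINE «run-pair organ» (header verbatim = the skeleton's), discharged by the landed
termination-line theorem `FlatRatioTermination.stub_windowTV` (p647765) — the two statements coincide. -/
theorem stub_windowTV : WindowTV :=
  Summit.QuantumFields.YangMills.Theorems.FlatRatioTermination.stub_windowTV

end Summit.QuantumFields.YangMills.Theorems.FluctuationComparisonRegPrIntL.RunPairOrgan
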